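import Mathlib.NumberTheory.Real.Irrational
import Mathlib.Analysis.Complex.Polynomial.Basic
import Literature.AlgebraicGeometry.Motives.FrobeniusTracesIndependentOfTheory
import Literature.NumberTheory.LFunctions.WeilConjecturesFactorizationProofs
import HarnessLib

/-!
# Odd Betti numbers are even when `q` is not a square: `μ_{√qⁱ} = μ_{−√qⁱ}` for a Weil factorisation

Topic `Literature/NumberTheory/LFunctions`; THEOREMS ONLY (no definition, no instance, no named fact).

## Source, verbatim

S. Sun, W. Zheng, *Parity and symmetry in intersection and ordinary cohomology*
[SunZheng2016ParitySymmetry], Introduction, the Remark after Corollary 1.4 (with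
`det(1 − T·F_q | Hⁿ(X_{𝔽̄}, ℚ_ℓ)) = ∏_λ (1 − λT)^{μ_λ}`): «The fact that (1.1) belongs to `ℤ[T]` implies
`μ_λ = μ_{λ'}` for `λ` and `λ'` in the same `Gal(ℚ̄/ℚ)`-orbit. In particular, `μ_λ = μ_{qⁿ/λ}`, and, if `q`
is not a square and `n` is odd, `μ_{√qⁿ} = μ_{−√qⁿ}`, so that `Hⁿ(X_{𝔽̄}, ℚ_ℓ) = Σ_λ μ_λ` is even in this
case.» (The general statement — `μ_{±√qⁿ}` even, `bₙ` even for `n` odd over any finite field — is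
Suh's theorem / Sun–Zheng Cor. 1.4, via an alternating perfect pairing; it is not proved here.)
M. Schütt [Schuett2013TwoLecturesK3], §6 p. 80: non-real Frobenius eigenvalues come in
«pairs of complex-conjugate eigenvalues».

## What is here

* §1 (fields `K → L`) **`rootMultiplicity_eq_rootMultiplicity_neg_of_sq_eq`**: if `d ∈ K` is not a
  square in `K` and `x² = d` in `L`, then every `P ∈ K[T]` has `mult_x P = mult_{−x} P` (the
  `Gal`-orbit `{x, −x}` of a root of the irreducible `T² − d`; proof by division by `T² − d`).
* §2 (`ℤ[T] → ℂ`) the non-real roots of an integral polynomial come in complex-conjugate pairs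
  (`even_card_roots_filter_im_ne_zero`); if all complex roots lie on the circle `|z| = ρ` with `ρ`
  irrational and `ρ² ∈ ℚ`, the real roots are `±ρ` with equal multiplicities, so **`deg P` is even**
  (`even_natDegree_of_norm_root_eq`).
* §3 For a Weil factorisation `IsWeilFactorization q n Z P` with `q` NOT a square and `i` odd:
  `q^{-i/2}` is irrational, **`mult_{q^{-i/2}} Pᵢ = mult_{−q^{-i/2}} Pᵢ`** and **`bᵢ = deg Pᵢ` is even**.
* §4 (E-level) for a Galois Weil cohomology `E` over a finite field `k` with the Lefschetz trace
  formula, `χ(φ) = q` and the Riemann hypothesis for `X` smooth projective: if `#k` is not a square,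
  **`dim_K Hⁱ(X)` is even for every odd `i ≤ 2 dim X`** (`even_finrank_of_odd`).

## References

* [SunZheng2016ParitySymmetry] S. Sun, W. Zheng, *Parity and symmetry in intersection and ordinary
  cohomology*, Algebra Number Theory 10 (2016) 235–307 (arXiv:1402.1292), Introduction, Cor. 1.4 and
  the Remark following it.
* [Schuett2013TwoLecturesK3] M. Schütt, *Two Lectures on the Arithmetic of K3 Surfaces*, Fields Inst.
  Commun. 67 (2013), §6.
* [Deligne1974] P. Deligne, *La conjecture de Weil. I*, Th. (1.6).

## Provenance

Lane `lit-hodgefound` (summit `HodgeConjecture`, Track 2 foundations library, Layer B: motives / zeta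
functions), seat `lit-hodgefound-p29` (literature-prover, generation 42, row g42-#7).
-/

universe u v

open Polynomial

noncomputable section

namespace Literature.Algebra.Polynomial

/-! ### §1 `mult_x P = mult_{−x} P` for `x² = d`, `d` not a square in the coefficient field -/

section Field

variable {K L : Type*} [Field K] [Field L] (ι : K →+* L)

/-- If `d` is not a square in `K`, `y² = d` in `L` and `Q ∈ K[T]` vanishes at `y`, then `T² − d ∣ Q`
(division with remainder by the monic `T² − d`: the remainder `aT + b` vanishes at `y ∉ ι(K)`).
[cite: SunZheng2016ParitySymmetry, Introduction, Remark after Cor. 1.4 («μ_λ = μ_{λ'} for λ and λ' in the same Gal(ℚ̄/ℚ)-orbit»)] -/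
theorem X_sq_sub_C_dvd_of_isRoot {d : K} (hd : ∀ y : K, y ^ 2 ≠ d) {y : L} (hy : y ^ 2 = ι d)
    {Q : K[X]} (hQ : (Q.map ι).IsRoot y) : X ^ 2 - C d ∣ Q := by
  set g : K[X] := X ^ 2 - C d with hg
  have hgm : g.Monic := monic_X_pow_sub_C d two_ne_zero
  have hg1 : g ≠ 1 := by
    intro h
    have h2 := congr_arg natDegree h
    rw [hg, natDegree_X_pow_sub_C, natDegree_one] at h2
    exact two_ne_zero h2
  rw [← modByMonic_eq_zero_iff_dvd hgm]
  have hgdeg : g.natDegree = 2 := by rw [hg, natDegree_X_pow_sub_C]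
  set r := Q %ₘ g with hr
  have hrdeg : r.natDegree ≤ 1 := by
    have h := natDegree_modByMonic_lt Q hgm hg1
    rw [hgdeg, ← hr] at h
    omega
  have hr_eq : r = C (r.coeff 1) * X + C (r.coeff 0) := eq_X_add_C_of_natDegree_le_one hrdeg
  -- evaluate `Q = r + g (Q / g)` at `y`
  have hgy : (g.map ι).eval y = 0 := by
    rw [hg, Polynomial.map_sub, Polynomial.map_pow, map_X, map_C, eval_sub, eval_pow, eval_X, eval_C,
      hy, sub_self]
  have hry : ι (r.coeff 1) * y + ι (r.coeff 0) = 0 := by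
    have h := modByMonic_add_div Q g
    rw [← hr] at h
    have h2 : (Q.map ι).eval y = (r.map ι).eval y + (g.map ι).eval y * ((Q /ₘ g).map ι).eval y := by
      rw [← h, Polynomial.map_add, Polynomial.map_mul, eval_add, eval_mul, h]
    rw [hQ.eq_zero, hgy, zero_mul, add_zero] at h2
    rw [hr_eq, Polynomial.map_add, Polynomial.map_mul, map_C, map_X, map_C, eval_add, eval_mul, eval_C,
      eval_X, eval_C] at h2
    exact h2.symm
  -- the remainder vanishes
  have ha : r.coeff 1 = 0 := by
    by_contra ha
    have ha' : ι (r.coeff 1) ≠ 0 := (map_ne_zero ι).mpr ha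
    have hyK : y = ι (-(r.coeff 0) / r.coeff 1) := by
      rw [map_div₀, map_neg, eq_div_iff ha', mul_comm]
      linear_combination hry
    apply hd (-(r.coeff 0) / r.coeff 1)
    apply ι.injective
    rw [map_pow, ← hyK, hy]
  have hb : r.coeff 0 = 0 := by
    rw [ha, map_zero, zero_mul, zero_add] at hry
    exact (map_eq_zero ι).mp hry
  rw [hr_eq, ha, hb, map_zero, zero_mul, zero_add]

/-- **`mult_x P = mult_{−x} P`** for every `P ∈ K[T]` when `x² = d ∈ K` is not a square in `K`
(`±x` are the `Gal`-conjugate roots of the irreducible `T² − d`). [cite: SunZheng2016ParitySymmetry, Introduction, Remark after Cor. 1.4] -/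
theorem rootMultiplicity_eq_rootMultiplicity_neg_of_sq_eq {d : K} (hd : ∀ y : K, y ^ 2 ≠ d) {x : L}
    (hx : x ^ 2 = ι d) (P : K[X]) :
    (P.map ι).rootMultiplicity x = (P.map ι).rootMultiplicity (-x) := by
  classical
  by_cases hxx : x = -x
  · rw [← hxx]
  suffices h : ∀ N : ℕ, ∀ Q : K[X], Q.natDegree ≤ N →
      (Q.map ι).rootMultiplicity x = (Q.map ι).rootMultiplicity (-x) from h _ P le_rfl
  intro N
  induction N with
  | zero =>
    intro Q hQ
    rw [eq_C_of_natDegree_le_zero hQ, map_C, rootMultiplicity_C, rootMultiplicity_C]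
  | succ N ih =>
    intro Q hQ
    by_cases hQ0 : Q = 0
    · rw [hQ0, Polynomial.map_zero, rootMultiplicity_zero, rootMultiplicity_zero]
    by_cases hroot : (Q.map ι).IsRoot x ∨ (Q.map ι).IsRoot (-x)
    · -- `T² − d ∣ Q`
      have hdvd : X ^ 2 - C d ∣ Q := by
        rcases hroot with h | h
        · exact X_sq_sub_C_dvd_of_isRoot ι hd hx h
        · exact X_sq_sub_C_dvd_of_isRoot ι hd (by rw [neg_sq, hx]) h
      obtain ⟨Q', hQ'⟩ := hdvd
      have hQ'0 : Q' ≠ 0 := by rintro rfl; exact hQ0 (by rw [hQ', mul_zero])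
      have hg0 : (X ^ 2 - C d : K[X]) ≠ 0 := (monic_X_pow_sub_C d two_ne_zero).ne_zero
      have hdeg : Q'.natDegree ≤ N := by
        have h := congr_arg natDegree hQ'
        rw [natDegree_mul hg0 hQ'0, natDegree_X_pow_sub_C] at h
        omega
      have hfac : (X ^ 2 - C d : K[X]).map ι = (X - C x) * (X - C (-x)) := by
        rw [Polynomial.map_sub, Polynomial.map_pow, map_X, map_C, ← hx, C_pow, map_neg]
        ring
      have hne : ((X - C x) * (X - C (-x))) * Q'.map ι ≠ 0 :=
        mul_ne_zero (mul_ne_zero (X_sub_C_ne_zero x) (X_sub_C_ne_zero (-x)))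
          ((Polynomial.map_ne_zero_iff ι.injective).mpr hQ'0)
      have hne' : (X - C x) * (X - C (-x)) ≠ (0 : L[X]) :=
        mul_ne_zero (X_sub_C_ne_zero x) (X_sub_C_ne_zero (-x))
      rw [hQ', Polynomial.map_mul, hfac, rootMultiplicity_mul hne, rootMultiplicity_mul hne,
        rootMultiplicity_mul hne', rootMultiplicity_mul hne', rootMultiplicity_X_sub_C_self,
        rootMultiplicity_X_sub_C, if_neg hxx, rootMultiplicity_X_sub_C, if_neg (Ne.symm hxx),
        rootMultiplicity_X_sub_C_self, ih Q' hdeg]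
    · rw [not_or] at hroot
      rw [rootMultiplicity_eq_zero hroot.1, rootMultiplicity_eq_zero hroot.2]

end Field

/-! ### §2 Integral polynomials with roots on a circle of irrational radius -/

section Complex

/-- A conjugation-stable multiset of non-real complex numbers has even cardinality (conjugation swaps
its upper and lower halves). [folklore] -/
private theorem even_card_of_map_conj_eq {T : Multiset ℂ} (hT : T.map (starRingEnd ℂ) = T)
    (him : ∀ z ∈ T, z.im ≠ 0) : Even (Multiset.card T) := by
  have hsplit : T = T.filter (fun z => 0 < z.im) + T.filter (fun z => z.im < 0) := by
    conv_lhs => rw [← Multiset.filter_add_not (fun z : ℂ => 0 < z.im) T]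
    refine congr_arg _ (Multiset.filter_congr fun z hz => ⟨fun h => ?_, fun h => not_lt.mpr h.le⟩)
    exact lt_of_le_of_ne (not_lt.mp h) (him z hz)
  have hswap : (T.filter fun z => 0 < z.im).map (starRingEnd ℂ) = T.filter fun z => z.im < 0 := by
    conv_rhs => rw [← hT]
    rw [Multiset.filter_map]
    exact congr_arg _ (Multiset.filter_congr fun z _ => by simp [Complex.conj_im])
  rw [hsplit, Multiset.card_add, ← hswap, Multiset.card_map]
  exact ⟨_, rfl⟩

/-- The multiset of complex roots of an integral polynomial is conjugation-stable. [folklore] -/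
private theorem map_conj_roots (P : ℤ[X]) :
    (P.map (Int.castRingHom ℂ)).roots.map (starRingEnd ℂ) = (P.map (Int.castRingHom ℂ)).roots := by
  have hcomp : (starRingEnd ℂ).comp (Int.castRingHom ℂ) = Int.castRingHom ℂ := RingHom.ext_int _ _
  rw [roots_map_of_injective_of_card_eq_natDegree (starRingEnd ℂ).injective
      (IsAlgClosed.splits _).natDegree_eq_card_roots.symm, Polynomial.map_map, hcomp]

/-- **The non-real roots of an integral polynomial come in complex-conjugate pairs**: their number,
with multiplicity, is even. [cite: Schuett2013TwoLecturesK3, §6 p. 80 («pairs of complex-conjugate eigenvalues»)]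
[cite: SunZheng2016ParitySymmetry, Introduction, Remark after Cor. 1.4] -/
theorem even_card_roots_filter_im_ne_zero (P : ℤ[X]) :
    Even (Multiset.card ((P.map (Int.castRingHom ℂ)).roots.filter fun z => z.im ≠ 0)) := by
  refine even_card_of_map_conj_eq ?_ fun z hz => (Multiset.mem_filter.mp hz).2
  conv_rhs => rw [← map_conj_roots P]
  rw [Multiset.filter_map]
  exact congr_arg _ (Multiset.filter_congr fun z _ => by simp [Complex.conj_im])

/-- On the circle `|z| = ρ` the real points are `±ρ`: the number of real roots (with multiplicity) of
`P` is `mult_ρ + mult_{−ρ}` when all roots have absolute value `ρ ≠ 0`.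
[cite: SunZheng2016ParitySymmetry, Introduction, Remark after Cor. 1.4] -/
theorem card_roots_filter_im_eq_zero (P : ℤ[X]) {ρ : ℝ} (hρ : ρ ≠ 0)
    (hRH : ∀ z : ℂ, (P.map (Int.castRingHom ℂ)).IsRoot z → ‖z‖ = ρ) :
    Multiset.card ((P.map (Int.castRingHom ℂ)).roots.filter fun z => z.im = 0) =
      (P.map (Int.castRingHom ℂ)).rootMultiplicity (ρ : ℂ) +
        (P.map (Int.castRingHom ℂ)).rootMultiplicity (-(ρ : ℂ)) := by
  set S := (P.map (Int.castRingHom ℂ)).roots with hS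
  have hmem : ∀ z ∈ S, z.im = 0 → z = ρ ∨ z = -ρ := by
    intro z hz him
    have hne : P.map (Int.castRingHom ℂ) ≠ 0 := fun h => by
      rw [hS, h, roots_zero] at hz
      exact Multiset.notMem_zero _ hz
    have hn := hRH z ((mem_roots hne).mp hz)
    have hz' : z = (z.re : ℂ) := Complex.ext (by simp) (by simp [him])
    have hre : |z.re| = ρ := by
      rw [← hn]
      conv_rhs => rw [hz']
      rw [Complex.norm_real, Real.norm_eq_abs]
    rcases abs_eq_abs.mp (show |z.re| = |ρ| by rw [hre, abs_of_nonneg (hre ▸ abs_nonneg _)]) with h | h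
    · left; rw [hz', h]
    · right; rw [hz', h, Complex.ofReal_neg]
  have hfilter : (S.filter fun z => z.im = 0) = S.filter fun z => z = (ρ : ℂ) ∨ z = -(ρ : ℂ) := by
    refine Multiset.filter_congr fun z hz => ⟨hmem z hz, fun h => ?_⟩
    rcases h with h | h
    · rw [h, Complex.ofReal_im]
    · rw [h, Complex.neg_im, Complex.ofReal_im, neg_zero]
  have hdisj : (S.filter fun z => z = (ρ : ℂ) ∧ z = -(ρ : ℂ)) = 0 := by
    refine Multiset.filter_eq_nil.mpr fun z _ h => hρ ?_
    have h2 : ((ρ : ℝ) : ℂ) = -((ρ : ℝ) : ℂ) := h.1.symm.trans h.2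
    have h3 : ρ = -ρ := by exact_mod_cast h2
    linarith
  have hsum := Multiset.filter_add_filter (fun z : ℂ => z = (ρ : ℂ)) (fun z : ℂ => z = -(ρ : ℂ)) S
  rw [hdisj, add_zero] at hsum
  rw [hfilter, ← hsum, Multiset.card_add, ← count_roots, ← count_roots, Multiset.count_eq_card_filter_eq,
    Multiset.count_eq_card_filter_eq]
  congr 1
  · exact congr_arg _ (Multiset.filter_congr fun z _ => eq_comm)
  · exact congr_arg _ (Multiset.filter_congr fun z _ => eq_comm)

/-- **`deg P` is even** when `P ∈ ℤ[T]` has all its complex roots on a circle `|z| = ρ` of irrational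
radius with `ρ² ∈ ℚ`: the non-real roots pair up by conjugation and `mult_ρ P = mult_{−ρ} P` (`±ρ` are
conjugate over `ℚ`). [cite: SunZheng2016ParitySymmetry, Introduction, Remark after Cor. 1.4 («if q is not a square and n is odd, μ_{√qⁿ} = μ_{−√qⁿ}, so that … is even»)] -/
theorem even_natDegree_of_norm_root_eq (P : ℤ[X]) {ρ : ℝ} (hirr : Irrational ρ) {d : ℚ}
    (hd : ρ ^ 2 = d) (hRH : ∀ z : ℂ, (P.map (Int.castRingHom ℂ)).IsRoot z → ‖z‖ = ρ) :
    (P.map (Int.castRingHom ℂ)).rootMultiplicity (ρ : ℂ) =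
        (P.map (Int.castRingHom ℂ)).rootMultiplicity (-(ρ : ℂ)) ∧
      Even P.natDegree := by
  classical
  have hρ0 : ρ ≠ 0 := hirr.ne_zero
  -- `d` is not a square in `ℚ`
  have hdQ : ∀ y : ℚ, y ^ 2 ≠ d := by
    intro y hy
    have h : ((y : ℝ)) ^ 2 = ρ ^ 2 := by rw [hd]; exact_mod_cast hy
    rcases sq_eq_sq_iff_eq_or_eq_neg.mp h with h' | h'
    · exact hirr.ne_rat y h'.symm
    · exact hirr.ne_rat (-y) (by push_cast; linarith)
  -- `mult_ρ = mult_{−ρ}` (§1 with `ℚ → ℂ`)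
  have hx : ((ρ : ℂ)) ^ 2 = algebraMap ℚ ℂ d := by
    rw [eq_ratCast, ← Complex.ofReal_ratCast, ← hd, Complex.ofReal_pow]
  have hcomp : (algebraMap ℚ ℂ).comp (Int.castRingHom ℚ) = Int.castRingHom ℂ := RingHom.ext_int _ _
  have hmult := rootMultiplicity_eq_rootMultiplicity_neg_of_sq_eq (algebraMap ℚ ℂ) hdQ hx
    (P.map (Int.castRingHom ℚ))
  rw [Polynomial.map_map, hcomp] at hmult
  refine ⟨hmult, ?_⟩
  -- count the roots: real ones `2 mult_ρ`, non-real ones in conjugate pairs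
  set S := (P.map (Int.castRingHom ℂ)).roots with hS
  have hc : Multiset.card (S.filter fun z => z.im = 0) + Multiset.card (S.filter fun z => z.im ≠ 0) =
      P.natDegree := by
    have h := congr_arg Multiset.card (Multiset.filter_add_not (fun z : ℂ => z.im = 0) S)
    rw [Multiset.card_add] at h
    refine h.trans ?_
    rw [hS, ← (IsAlgClosed.splits _).natDegree_eq_card_roots,
      natDegree_map_eq_of_injective (Int.castRingHom ℂ).injective_int]
  rw [← hc, card_roots_filter_im_eq_zero P hρ0 hRH, ← hmult]
  exact (Even.add ⟨_, rfl⟩ (even_card_roots_filter_im_ne_zero P))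

end Complex

end Literature.Algebra.Polynomial

/-! ### §3 Weil factorisations with `q` not a square: `μ_{√qⁱ} = μ_{−√qⁱ}` and `bᵢ` even for `i` odd -/

namespace Literature.AlgebraicGeometry.Motives.IsWeilFactorization

variable {q n : ℕ} {Z : PowerSeries ℚ} {P : Fin (2 * n + 1) → ℤ[X]}

/-- `q^{-i/2} = (√q ^ i)⁻¹`. [folklore] -/
private theorem rpow_neg_half_eq (q i : ℕ) : (q : ℝ) ^ (-(i : ℝ) / 2) = (Real.sqrt q ^ i)⁻¹ := by
  have hq0 : (0 : ℝ) ≤ q := Nat.cast_nonneg q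
  rw [neg_div, Real.rpow_neg hq0, show ((i : ℝ) / 2) = (1 / 2 : ℝ) * (i : ℕ) by ring, Real.rpow_mul hq0,
    Real.rpow_natCast, ← Real.sqrt_eq_rpow]

/-- **`q^{-i/2}` is irrational for `q` not a square and `i` odd** (`= (q^k √q)⁻¹`, `i = 2k + 1`).
[cite: SunZheng2016ParitySymmetry, Introduction, Remark after Cor. 1.4] -/
theorem irrational_rpow_neg_half (hq : ¬IsSquare q) {i : ℕ} (hi : Odd i) :
    Irrational ((q : ℝ) ^ (-(i : ℝ) / 2)) := by
  rw [rpow_neg_half_eq]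
  obtain ⟨k, rfl⟩ := hi
  have hq0 : q ≠ 0 := by
    rintro rfl
    exact hq ⟨0, rfl⟩
  have hsqrt : Irrational (Real.sqrt q) := irrational_sqrt_natCast_iff.mpr hq
  have h : Real.sqrt q ^ (2 * k + 1) = ((q ^ k : ℕ) : ℝ) * Real.sqrt q := by
    rw [pow_succ, pow_mul, Real.sq_sqrt (Nat.cast_nonneg _), Nat.cast_pow]
  rw [h]
  exact (hsqrt.natCast_mul (pow_ne_zero k hq0)).inv

/-- `(q^{-i/2})² = q^{-i} ∈ ℚ`. [folklore] -/
private theorem sq_rpow_neg_half (q i : ℕ) :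
    ((q : ℝ) ^ (-(i : ℝ) / 2)) ^ 2 = ((((q : ℚ) ^ i)⁻¹ : ℚ) : ℝ) := by
  rw [rpow_neg_half_eq, inv_pow, ← pow_mul, mul_comm, pow_mul, Real.sq_sqrt (Nat.cast_nonneg _)]
  push_cast
  rfl

/-- **`μ_{√qⁱ} = μ_{−√qⁱ}`** («if `q` is not a square and `n` is odd, `μ_{√qⁿ} = μ_{−√qⁿ}`»): for a Weil
factorisation with `q` not a square and `i` odd, the real points `±q^{-i/2}` of the circle
`|z| = q^{-i/2}` are roots of `Pᵢ` with the same multiplicity.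
[cite: SunZheng2016ParitySymmetry, Introduction, Remark after Cor. 1.4] [cite: Deligne1974, Thm. (1.6)] -/
theorem rootMultiplicity_eq_rootMultiplicity_neg (hq : ¬IsSquare q) (hW : IsWeilFactorization q n Z P)
    (i : Fin (2 * n + 1)) (hi : Odd (i : ℕ)) :
    ((P i).map (Int.castRingHom ℂ)).rootMultiplicity (((q : ℝ) ^ (-((i : ℕ) : ℝ) / 2) : ℝ) : ℂ) =
      ((P i).map (Int.castRingHom ℂ)).rootMultiplicity (-(((q : ℝ) ^ (-((i : ℕ) : ℝ) / 2) : ℝ) : ℂ)) :=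
  (Literature.Algebra.Polynomial.even_natDegree_of_norm_root_eq (P i) (irrational_rpow_neg_half hq hi)
    (sq_rpow_neg_half q i) (hW.2.2.2.2 i)).1

/-- **`bᵢ = deg Pᵢ` is even for `i` odd when `q` is not a square** («so that `Hⁿ(X_𝔽̄, ℚ_ℓ) = Σ_λ μ_λ`
is even in this case»). [cite: SunZheng2016ParitySymmetry, Introduction, Remark after Cor. 1.4]
[cite: Deligne1974, Thm. (1.6)] -/
theorem even_natDegree_of_odd (hq : ¬IsSquare q) (hW : IsWeilFactorization q n Z P)
    (i : Fin (2 * n + 1)) (hi : Odd (i : ℕ)) : Even (P i).natDegree :=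
  (Literature.Algebra.Polynomial.even_natDegree_of_norm_root_eq (P i) (irrational_rpow_neg_half hq hi)
    (sq_rpow_neg_half q i) (hW.2.2.2.2 i)).2

end Literature.AlgebraicGeometry.Motives.IsWeilFactorization

/-! ### §4 E-level: odd Betti numbers of `X` are even when `#k` is not a square -/

namespace Literature.AlgebraicGeometry.Motives.GaloisWeilCohomology

open Literature.NumberTheory.LFunctions

variable {k : Type u} [Field k] [Finite k] {K : Type v} [Field K] [CharZero K]
  {χ : Field.absoluteGaloisGroup k →* Kˣ} (E : GaloisWeilCohomology k K χ)
variable {d : ℕ} {X : SchemeOver k}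

/-- **Odd Betti numbers are even (the case `#k` not a square)**: for a Galois Weil cohomology `E` over
the finite field `k` satisfying the Lefschetz trace formula, with `χ(φ) = #k` and the Riemann hypothesis
for the smooth projective `X` of dimension `d`, if `#k` is not a square then `dim_K Hⁱ(X)` is even for
every odd `i ≤ 2d` — the elementary case of Suh's theorem / Sun–Zheng Cor. 1.4 («if `q` is not a square
and `n` is odd, `μ_{√qⁿ} = μ_{−√qⁿ}`, so that `Hⁿ(X_𝔽̄, ℚ_ℓ) = Σ_λ μ_λ` is even in this case»).
[cite: SunZheng2016ParitySymmetry, Introduction, Cor. 1.4 and the Remark following it] [cite: Deligne1974, Thm. (1.6)] -/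
theorem even_finrank_of_odd (hE : E.HasLefschetzTraceFormula)
    (hχ : ((χ (arithFrob k) : Kˣ) : K) = Nat.card k) (hX : IsSmoothProjective d X)
    (hRH : E.WeilRiemannHypothesisFor X d) (hq : ¬IsSquare (Nat.card k)) {i : ℕ} (hi : Odd i)
    (hid : i ≤ 2 * d) :
    Even (haveI := E.finite_obj hX i; Module.finrank K (E.obj X i)) := by
  obtain ⟨P, hP, hroots⟩ := hRH
  have hW := isWeilFactorization_of_isIntegralModel E hE hχ hX hP hroots
  have h : (haveI := E.finite_obj hX i; Module.finrank K (E.obj X i)) = (P ⟨i, by omega⟩).natDegree :=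
    E.finrank_eq_natDegree_of_isIntegralModel hX (hP ⟨i, by omega⟩)
  rw [h]
  exact hW.even_natDegree_of_odd hq ⟨i, by omega⟩ hi

end Literature.AlgebraicGeometry.Motives.GaloisWeilCohomology

end
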